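import Literature.ComputerArithmetic.RumpOgitaOishi2008.AccSum
import Mathlib.Data.Sign.Defs

/-!
# Rump–Ogita–Oishi, *Accurate floating-point summation part II*: §3 `Transform(p, ϱ)` with offset and
# parameter `Φ` (Algorithm 3.3, Lemmas 3.4–3.5) and §4 the sign of a sum, `AccSign` (Algorithm 4.1, Theorem 4.2)

HONEST FRAMING (ENGINES group, unit `eng-quad-4`, kernels lane of the `certquad` engine — shared
numerical engines serving client cells; rigour lives in the verifiers; every published number
belongs to a client cell's ledger, not to the engines group): Part II of the source is typed and proved at
FORMAT LEVEL, in the model of the lane's Part I files (`RumpOgitaOishi2008.ExtractVector`, `.AccSum`) — the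
tree's binary floating-point numbers `JeannerodRump2018.IsFloat p emin` (precision `p`, gradual underflow from
`emin`, NO overflow) and ANY round-to-nearest map `JeannerodRump2018.IsRoundNearest p emin fl` (no tie rule
fixed). This file carries §3 (the transformation `Transform(p⁽⁰⁾, ϱ)` with an offset `ϱ` and a parameterized
"until"-condition `|t⁽ᵐ⁾| ≥ fl(Φσₘ₋₁)`, its invariant LEMMA 3.4, and LEMMA 3.5 on `res = fl(τ₁ + (τ₂ + Σ p′ᵢ))`
incl. the estimates (3.12)–(3.17) that Part II's later sections reuse) and §4 (ALGORITHM 4.1 `AccSign` and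
THEOREM 4.2: with `Φ = 2ᴹeps` the sign of `τ₁` IS the sign of `Σ pᵢ`, "only requiring `2ᴹeps < 1`", i.e. for
huge lengths) — all PROVED. No hardware, vendor, timing, flop-count or IEEE-format claims: `p` and `emin` are
parameters (`2ᴹeps < 1` becomes `Nat.clog 2 (n + 2) < p`, `2²ᴹeps ≤ 1` becomes `2·Nat.clog 2 (n + 2) ≤ p`).

Source read at the page: [RumpOgitaOishi2009] S. M. Rump, T. Ogita, S. Oishi, *Accurate floating-point
summation part II: sign, K-fold faithful and rounding to nearest*, SIAM J. Sci. Comput. 31(2) (2008/09)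
1269–1302, doi:10.1137/07068816X; read in the authors' version (30 pp.; its page numbers are used): pp. 2–4
(§2: `F`, `U`, `eps`, `eta`, `ufp`, `epsσℤ`, eqs. (2.1)–(2.14), Lemma 2.1, Definition 2.2, Lemma 2.3, Algorithm 2.4,
Lemma 2.5), p. 5 (Algorithm 3.1 = Part I `ExtractVector`, Theorem 3.2 =
Part I Theorem 3.4, eq. (3.1), Algorithm 3.3 `Transform(p⁽⁰⁾, ϱ)`, Lemma 3.4, eq. (3.2)), p. 6 (eqs. (3.3)–(3.6),
the Remark on `ϱ ∈ epsσ₀ℤ`, proof of Lemma 3.4, the application with `ϱ = p₁`, Lemma 3.5, eq. (3.7)), p. 7 (eqs.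
(3.8)–(3.17), proof of Lemma 3.5, §4 introduction), p. 8 (Algorithm 4.1 `AccSign`, Theorem 4.2, eq. (4.1), its
proof with eq. (4.2), the optimality example (4.3), the applicability remark).

DICTIONARY (source ↦ here; carriers `ℚ`; the dictionaries of `ExtractVector` and `AccSum` — `F`, `fl`,
`eps ↦ unitRoundoff p = 2^-p`, `eta ↦ 2^emin`, `½eps⁻¹eta ↦ 2^(emin+p-1)`, `ufp`, `gℤ ↦ OnGrid g`, `σ = 2^k`,
`FastTwoSum ↦ fast2Sum`, `ExtractVector ↦ extractVector`, `μ ↦ maxAbs`, `M = ⌈log₂(n+2)⌉ ↦ Nat.clog 2 (n + 2)`,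
`⌈log₂ μ⌉ ↦ Int.clog 2 μ`, `fl(Σ p′ᵢ) ↦ flSum` / `SumTree.eval` — continue).
* Algorithm 3.3: the "repeat–until" loop ↦ `transformPhiAux fl M eps Φ (½eps⁻¹eta) fuel t σ p` (structural
  recursion on a pass budget, loop state `(t⁽ᵐ⁻¹⁾, σₘ₋₁, p⁽ᵐ⁻¹⁾)`, exactly Part I's `transformAux` with `fl(Φσ)`
  for `fl(2²ᴹepsσ)` in the "until"-condition: `transformPhiAux_two_pow_two_mul`);
  `Transform(p⁽⁰⁾, ϱ) = [τ₁, τ₂, p⁽ᵐ⁾, σ]` ↦ `transformPhi fl p emin Φ xs ϱ : ℚ × ℚ × List ℚ × ℚ` (`t⁽⁰⁾ = ϱ`; the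
  fifth output `M` of the source is the closed expression `Nat.clog 2 (n + 2)`); "parameter `Φ` replaced by
  `2²ᴹeps`" / "by `2ᴹeps`" ↦ the argument `Φ := 2 ^ (2 * M) * unitRoundoff p` / `2 ^ M * unitRoundoff p`; in the
  lemmas `Φ = 2ᵃeps` with `a ≤ p` renders "`Φ` a power of 2 satisfying `eps ≤ Φ ≤ 1`".
* Lemma 3.4's assertions (3.2)–(3.5) on `[τ₁, τ₂, p⁽ᵐ⁾, σ]` for the final `m` (the last pass's `t⁽ᵐ⁻¹⁾`, `τ⁽ᵐ⁾`
  existentially quantified; `s + ϱ` as one quantity `s'`) ↦ `TransformPhiSpec p emin fl M Φ s' n τ₁ τ₂ p⁽ᵐ⁾ σ`;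
  for `Φ = 2²ᴹeps` it yields Part I's `TransformSpec` (`TransformPhiSpec.toTransformSpec`), so that Part I's
  Lemma 4.3 machinery (`faithful_of_transformSpec[_tree]`) applies verbatim to `s + ϱ`.
* (3.7) `res = fl(τ₁ + (τ₂ + Σ p′ᵢ))` after `Transform(p, ϱ)` with `Φ = 2²ᴹeps` ↦ `accSumOffset fl p emin xs ϱ`
  (`accSumOffset_zero`: with `ϱ = 0` it is Part I's `accSum`).
* Algorithm 4.1: `S = AccSign(p) = sign(τ₁)` ↦ `accSign fl p emin xs : SignType` (`SignType.sign τ₁`);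
  `sign(Σ pᵢ)` ↦ `SignType.sign xs.sum`.

Typed and PROVED (all sorry-free; `[cite: …]` locators on every declaration):

* ALGORITHM 3.3 — `transformPhiAux`, `transformPhi`, `transformPhi_of_maxAbs_eq_zero`; "for `ϱ = 0` …
  identical to Algorithm 4.1 in Part I with `Φ = 2²ᴹeps`": `transformPhiAux_two_pow_two_mul`,
  `transformPhi_two_pow_two_mul_zero`.
* LEMMA 3.4 — `TransformPhiSpec` (+ `toTransformSpec`); `transformPhiAux_spec` (the loop under `2ᴹeps < 1` and
  `eps ≤ Φ = 2ᵃeps ≤ 1`: invariant (3.2)–(3.3), (3.6) and the exactness of `t⁽ᵐ⁾ = fl(t⁽ᵐ⁻¹⁾ + τ⁽ᵐ⁾)` while the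
  loop continues, `FastTwoSum` at the exit, (3.4), the first "until"-condition at a stop with `σ > ½eps⁻¹eta`);
  `transformPhi_spec` (Lemma 3.4 for Algorithm 3.3 on a nonzero vector and `ϱ ∈ F ∩ epsσ₀ℤ`);
  `TransformPhiSpec.fl_add_eq` ((3.4) `fl(τ₁ + τ₂) = τ₁`, and `τ₁, τ₂ ∈ epsσℤ`), `.eq_zero_of_le` (`σ ≤ ½eps⁻¹eta ⟹
  p⁽ᵐ⁾ = 0`, `s + ϱ = τ₁ + τ₂`), `.phi_mul_le_ufp` ((3.5) `ufp(τ₁) ≥ Φσ`), `.last_printed` ((3.3) as printed,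
  `|τ⁽ᵐ⁾| ≤ (1 − 2⁻ᴹ)σ < σ`).
* LEMMA 3.5 — `accSumOffset`, `accSumOffset_zero`, `accSumOffset_of_maxAbs_eq_zero`;
  `accSumOffset_spec_of_maxAbs_ne_zero` (faithful rounding of `s + ϱ`, the `res = 0` clause, (3.10));
  `isFaithfulRounding_accSumOffset` (all vectors); `transformPhi_eqs` ((3.8), (3.9), (3.11) and the
  `σ ≤ ½eps⁻¹eta` clause); `estimates_of_transformSpec` ((3.12)–(3.17) over Part I's `TransformSpec` and an
  abstract `τ₃ = fl(Σ p′ᵢ)` obeying (3.14) and Part I (2.20)); `accSumOffset_estimates` ((3.14)–(3.17) for the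
  code (3.7)).
* ALGORITHM 4.1 / THEOREM 4.2 — `accSign`; `transformPhi_fst_pos_iff_and_neg_iff` (`τ₁ > 0 ⟺ s > 0`,
  `τ₁ < 0 ⟺ s < 0` for `Transform(p, 0)` with `Φ = 2ᴹeps` under `2ᴹeps < 1`); `accSign_eq_sign_sum` ((4.1)
  `S = sign(Σ pᵢ)`); `accSign_eq_iff` (the three cases; `S = 0 ⟺ Σ pᵢ = 0` exactly); `clog_lt_iff` (`2ᴹeps < 1 ⟺
  n + 2 ≤ 2^(p−1)`, the applicability remark); the two elementary sign lemmas `pos_iff_and_neg_iff_of_abs_lt`,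
  `pos_iff_and_neg_iff_of_fl_eq` used in the proof.

NOTES. (a) HYPOTHESES AND TIE RULE. Everything here holds for EVERY round-to-nearest `fl` (no tie rule),
with `p` and `emin` free. Lemma 3.4 and Theorem 4.2 need only `2ᴹeps < 1` (`M < p`; Part I's `ExtractVector`
NOTE (a) on ties is not met with); Lemma 3.5 keeps Part I's `2²ᴹeps ≤ 1`. "`Φ` a power of 2 with `eps ≤ Φ ≤ 1`"
is rendered `Φ = 2ᵃeps`, `a ≤ p` (`a = M` for `AccSign`, `a = 2M` for (3.7)/`AccSum`). The offset must satisfy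
`ϱ ∈ F ∩ epsσ₀ℤ` (`OnGrid (unitRoundoff p * 2^(M + ⌈log₂ μ⌉)) ϱ`), exactly the source's assumption (its Remark,
p. 6, explains why it cannot be dropped).
(b) FUEL, as in Part I: the `repeat–until` loop is structural recursion on a pass budget and Lemma 3.4
(`transformPhiAux_spec`, hypothesis `k − emin < fuel` for `σ = 2^k`) shows the budget chosen by `transformPhi`
is never exhausted ("Algorithm 3.3 will stop" / "Algorithm `AccSign` will stop"), so `transformPhi` IS
Algorithm 3.3 on every input.
(c) THE OPTIMALITY EXAMPLE (4.3) is discussed, not typed (it fixes rounding TIES TO EVEN, which the format-level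
model here deliberately leaves open, and is a statement about one concrete run): `p⁽⁰⁾ = [c c c c −⅛eps⁻¹ −4+4eps]`,
`c = eps⁻¹/32 + 1`, `M = 3`, `σ₀ = eps⁻¹`, `Φ = 2ᴹ⁻¹eps` gives `τ₁ = −4` while `s = +4eps`. Replaying it in exact
rational arithmetic with ties-to-even (precision `p`, `eps = 2⁻ᵖ`) confirms the wrong sign for `p = 7, 8, 10` but
NOT for the printed boundary case `eps = 1/64` (`p = 6`): there `σ₀ + c = 67` is a tie whose even neighbour is
`68`, so `q₁ = … = q₄ = 4`, `τ⁽¹⁾ = +4` and `AccSign` returns the correct sign; the example needs `eps ≤ 1/128`.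
With `Φ = 2ᴹeps` the sign is correct in all these runs, as Theorem 4.2 (proved here for every `p > M`) demands.
(d) (3.10) and (3.17) are stated for `res ≠ 0` / in the case `σ > ½eps⁻¹eta` as in the source; for `res = 0`
Lemma 3.5 gives `s + ϱ = 0 = res` exactly.
(e) NOT typed here: §2's recapitulation of Part I — eqs. (2.1)–(2.14), Lemma 2.1 (`pred`/`succ`; the
cases used are Part I Lemma 2.2 in `RumpOgitaOishi2008.AccSum`), Definition 2.2 and Lemma 2.3 (faithful
rounding and its criterion, Part I Definition 2.3 / Lemma 2.4, ibid.), Algorithm 2.4 / Lemma 2.5 (`FastTwoSum`,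
Part I Lemma 2.6, `RumpOgitaOishi2008.ExtractVector`) —, Theorem 3.2 (= Part I Theorem 3.4,
`extractVector_eft`), the flop counts, and §§5–9 of Part II (K-fold faithful rounding `AccSumK`, rounding to
nearest `NearSum`, `AccSumHugeN`, timings) — the subject of later files.
-/

namespace Literature.ComputerArithmetic.RumpOgitaOishi2009

open Literature.ComputerArithmetic.JeannerodRump2018
open Literature.ComputerArithmetic.JeannerodRump2018.SumTree
open Literature.ComputerArithmetic.BoldoJeannerodMelquiondMuller2023
open Literature.ComputerArithmetic.JoldesMullerPopescu2017 (isFloat_two_zpow two_zpow_emin_le_abs)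
open Literature.ComputerArithmetic.LangeRump2018 (abs_list_sum_le exact_eq_leaves_sum)
open Literature.ComputerArithmetic.RumpOgitaOishi2008

variable {p : ℕ} {emin : ℤ} {fl : ℚ → ℚ}

/-! ### §3, Algorithm 3.3: `Transform(p⁽⁰⁾, ϱ)` with offset `ϱ` and stopping parameter `Φ` -/

/-- **ALGORITHM 3.3 (`Transform` with offset), the `repeat–until` loop**, with the loop state
`(t⁽ᵐ⁻¹⁾, σₘ₋₁, p⁽ᵐ⁻¹⁾)` and explicit fuel: one pass computes `[τ⁽ᵐ⁾, p⁽ᵐ⁾] = ExtractVector(σₘ₋₁, p⁽ᵐ⁻¹⁾)`,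
`t⁽ᵐ⁾ = fl(t⁽ᵐ⁻¹⁾ + τ⁽ᵐ⁾)`, `σₘ = fl(2ᴹeps·σₘ₋₁)`, and stops — returning `[τ₁, τ₂] = FastTwoSum(t⁽ᵐ⁻¹⁾, τ⁽ᵐ⁾)`,
`p⁽ᵐ⁾`, `σ = σₘ₋₁` — when `|t⁽ᵐ⁾| ≥ fl(Φσₘ₋₁)` or `σₘ₋₁ ≤ ½eps⁻¹eta` (`eta₂`); it differs from Part I's
Algorithm 4.1 (`RumpOgitaOishi2008.transformAux`) only in the parameter `Φ` of the "until"-condition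
(there `Φ = 2²ᴹeps`, `transformPhiAux_two_pow_two_mul`). With fuel `0` it returns the current state unchanged
(never reached with the fuel supplied by `transformPhi`, Lemma 3.4).
[cite: RumpOgitaOishi2009, Algorithm 3.3] -/
def transformPhiAux (fl : ℚ → ℚ) (M : ℕ) (u Φ eta₂ : ℚ) : ℕ → ℚ → ℚ → List ℚ → ℚ × ℚ × List ℚ × ℚ
  | 0, t, σ, xs => (t, 0, xs, σ)
  | fuel + 1, t, σ, xs =>
      if fl (Φ * σ) ≤ |fl (t + (extractVector fl σ xs).1)| ∨ σ ≤ eta₂ then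
        ((fast2Sum fl t (extractVector fl σ xs).1).1, (fast2Sum fl t (extractVector fl σ xs).1).2,
          (extractVector fl σ xs).2, σ)
      else
        transformPhiAux fl M u Φ eta₂ fuel (fl (t + (extractVector fl σ xs).1)) (fl (2 ^ M * u * σ))
          (extractVector fl σ xs).2

/-- **ALGORITHM 3.3 (`Transform(p⁽⁰⁾, ϱ)`, depending on the parameter `Φ`): transformation of a vector `p⁽⁰⁾`
plus offset `ϱ`** into `[τ₁, τ₂, p⁽ᵐ⁾, σ]`: `μ = max |p⁽⁰⁾ᵢ|`; if `μ = 0` then `τ₁ = ϱ`, `τ₂ = σ = 0`, `p⁽ᵐ⁾ = 0`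
(`= p⁽⁰⁾`, the zero vector); else `M = ⌈log₂(n + 2)⌉`, `σ₀ = 2^(M + ⌈log₂ μ⌉)`, `t⁽⁰⁾ = ϱ` and the loop
`transformPhiAux` (run with fuel `M + ⌈log₂ μ⌉ − emin + 1`, more than the number of passes, Lemma 3.4; the
source also returns `M`, which is the closed expression `Nat.clog 2 (n + 2)` here). The format parameters
`p` (`eps = 2^-p`) and `emin` (`½eps⁻¹eta = 2^(emin+p-1)`) are arguments as in Part I.
[cite: RumpOgitaOishi2009, Algorithm 3.3] -/
def transformPhi (fl : ℚ → ℚ) (p : ℕ) (emin : ℤ) (Φ : ℚ) (xs : List ℚ) (ϱ : ℚ) : ℚ × ℚ × List ℚ × ℚ :=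
  if maxAbs xs = 0 then (ϱ, 0, xs, 0)
  else
    transformPhiAux fl (Nat.clog 2 (xs.length + 2)) (unitRoundoff p) Φ ((2 : ℚ) ^ (emin + p - 1))
      (((Nat.clog 2 (xs.length + 2) : ℤ) + Int.clog 2 (maxAbs xs) - emin).toNat + 1) ϱ
      ((2 : ℚ) ^ ((Nat.clog 2 (xs.length + 2) : ℤ) + Int.clog 2 (maxAbs xs))) xs

/-- "For `ϱ = 0`, Algorithm `Transform` is identical to Algorithm 4.1 in Part I with the parameter
`Φ = 2²ᴹeps`" — the loop. [cite: RumpOgitaOishi2009, Lemma 3.4 (proof, first paragraph)] -/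
theorem transformPhiAux_two_pow_two_mul (fl : ℚ → ℚ) (M : ℕ) (u eta₂ : ℚ) :
    ∀ (fuel : ℕ) (t σ : ℚ) (xs : List ℚ),
      transformPhiAux fl M u (2 ^ (2 * M) * u) eta₂ fuel t σ xs = transformAux fl M u eta₂ fuel t σ xs
  | 0, _, _, _ => rfl
  | fuel + 1, t, σ, xs => by
      simp only [transformPhiAux, transformAux, transformPhiAux_two_pow_two_mul fl M u eta₂ fuel]

/-- "For `ϱ = 0`, Algorithm `Transform` is identical to Algorithm 4.1 in Part I with the parameter
`Φ = 2²ᴹeps`": `Transform(p, 0)` with `Φ = 2²ᴹeps` is `RumpOgitaOishi2008.transform p`.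
[cite: RumpOgitaOishi2009, Lemma 3.4 (proof, first paragraph)] -/
theorem transformPhi_two_pow_two_mul_zero (fl : ℚ → ℚ) (p : ℕ) (emin : ℤ) (xs : List ℚ) :
    transformPhi fl p emin (2 ^ (2 * Nat.clog 2 (xs.length + 2)) * unitRoundoff p) xs 0 =
      transform fl p emin xs := by
  unfold transformPhi transform
  split_ifs with h
  · rfl
  · exact transformPhiAux_two_pow_two_mul fl _ _ _ _ _ _ _

/-- On the zero vector `Transform(p, ϱ)` returns `τ₁ = ϱ`, `τ₂ = σ = 0` and `p⁽ᵐ⁾ = p⁽⁰⁾ (= 0)`.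
[cite: RumpOgitaOishi2009, Algorithm 3.3 ("if μ = 0")] -/
theorem transformPhi_of_maxAbs_eq_zero (fl : ℚ → ℚ) (p : ℕ) (emin : ℤ) (Φ : ℚ) {xs : List ℚ} (ϱ : ℚ)
    (h : maxAbs xs = 0) : transformPhi fl p emin Φ xs ϱ = (ϱ, 0, xs, 0) := by
  rw [transformPhi, if_pos h]

/-! ### §3, Lemma 3.4: the loop invariant and the stopping state of `Transform(p⁽⁰⁾, ϱ)` -/

/-- The assertions of LEMMA 3.4 on the results `[τ₁, τ₂, p⁽ᵐ⁾, σ]` of `Transform(p⁽⁰⁾, ϱ)` run with the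
parameter `Φ` (`σ = σₘ₋₁`, with `t = t⁽ᵐ⁻¹⁾`, `τ = τ⁽ᵐ⁾` the values of the last pass), for `s' := s + ϱ` the exact
sum-plus-offset of the input of length `n`: `σ = 2^k ≥ eta` (`two_zpow`); `p⁽ᵐ⁾` has length `n`, entries in `F`
with (3.3) `max |p⁽ᵐ⁾ᵢ| ≤ epsσ`; `τ₁, τ₂ ∈ F`; (3.2) `s + ϱ = t + τ + Σ p⁽ᵐ⁾ᵢ`, (3.3) `t, τ ∈ F ∩ epsσℤ`,
`|τ| ≤ n·2⁻ᴹσ < σ` (Theorem 3.2, the form behind the printed `|τ| ≤ (1 − 2⁻ᴹ)σ`), (3.4) `τ₁ + τ₂ = t + τ`,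
`τ₁ = fl(t + τ) = t⁽ᵐ⁾`, `|τ₂| ≤ eps·ufp(τ₁)` (`last`); and the first "until"-condition at a stop with
`σ > ½eps⁻¹eta`: `|τ₁| ≥ Φσ` (hence (3.5) `ufp(τ₁) ≥ Φσ`, `exit`; `TransformPhiSpec.phi_mul_le_ufp`).
For `Φ = 2²ᴹeps` these are the assertions of Part I, Lemma 4.2 (`toTransformSpec`).
[cite: RumpOgitaOishi2009, Lemma 3.4 eqs. (3.2)–(3.5)] -/
structure TransformPhiSpec (p : ℕ) (emin : ℤ) (fl : ℚ → ℚ) (M : ℕ) (Φ s' : ℚ) (n : ℕ)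
    (τ₁ τ₂ : ℚ) (xs' : List ℚ) (σ : ℚ) : Prop where
  two_zpow : ∃ k : ℤ, emin ≤ k ∧ σ = (2 : ℚ) ^ k
  length_eq : xs'.length = n
  low : ∀ x ∈ xs', IsFloat p emin x ∧ |x| ≤ unitRoundoff p * σ
  isFloat₁ : IsFloat p emin τ₁
  isFloat₂ : IsFloat p emin τ₂
  last : ∃ t τ : ℚ, IsFloat p emin t ∧ IsFloat p emin τ ∧ OnGrid (unitRoundoff p * σ) t ∧
    OnGrid (unitRoundoff p * σ) τ ∧ |τ| ≤ (n : ℚ) * (σ / 2 ^ M) ∧ (n : ℚ) * (σ / 2 ^ M) < σ ∧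
    s' = t + τ + xs'.sum ∧ τ₁ + τ₂ = t + τ ∧ τ₁ = fl (t + τ) ∧ |τ₂| ≤ unitRoundoff p * ufp τ₁
  exit : (2 : ℚ) ^ (emin + p - 1) < σ → Φ * σ ≤ |τ₁|

/-- For `Φ = 2²ᴹeps` the assertions of Lemma 3.4 are those of Part I, Lemma 4.2 (`TransformSpec`, for the sum
`s + ϱ`). [cite: RumpOgitaOishi2009, Lemma 3.4 (proof, first paragraph)] -/
theorem TransformPhiSpec.toTransformSpec {M : ℕ} {s' : ℚ} {n : ℕ} {τ₁ τ₂ σ : ℚ} {xs' : List ℚ}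
    (H : TransformPhiSpec p emin fl M (2 ^ (2 * M) * unitRoundoff p) s' n τ₁ τ₂ xs' σ) :
    TransformSpec p emin fl M s' n τ₁ τ₂ xs' σ where
  two_zpow := H.two_zpow
  length_eq := H.length_eq
  low := H.low
  isFloat₁ := H.isFloat₁
  isFloat₂ := H.isFloat₂
  last := by
    obtain ⟨t, τ, htF, hτF, htg, hτg, hτle, hnσ, hs, h12, h1, hτ₂⟩ := H.last
    exact ⟨t, τ, htF, hτF, htg, hτg, hτle.trans_lt hnσ, hs, h12, h1, hτ₂⟩
  exit := H.exit

/-- **LEMMA 3.4, the loop** ("carefully going through the proof of Lemma 4.2 in Part I we identify the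
necessary changes"). Entering a pass with `σ = 2^k`, `k ≥ emin`, `p⁽ᵐ⁻¹⁾` of length `n` with `n + 2 ≤ 2^M`,
entries in `F` bounded by `2^-M σ`, `t⁽ᵐ⁻¹⁾ ∈ F ∩ epsσℤ`, `s' = t⁽ᵐ⁻¹⁾ + Σ p⁽ᵐ⁻¹⁾ᵢ`, `2ᴹeps < 1` (`M < p`) and
`Φ = 2ᵃeps` a power of two with `eps ≤ Φ ≤ 1` (`a ≤ p`), the loop terminates (within `k − emin + 1` passes) in
a state satisfying `TransformPhiSpec`: while it continues, `σₘ₋₁ > ½eps⁻¹eta` makes `σₘ = 2ᴹepsσₘ₋₁` and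
`Φσₘ₋₁` exact powers of two ("no rounding error occurred in the computation of `Φσₘ₋₂` … under our assumption
`eps ≤ Φ ≤ 1`"), (3.6) `|t⁽ᵐ⁾| < Φσₘ₋₁ ≤ σₘ₋₁` makes `t⁽ᵐ⁾ = t⁽ᵐ⁻¹⁾ + τ⁽ᵐ⁾` exact, and Theorem 3.2 (which needs
only `2ᴹ > n`, `2ᴹeps < 1`) supplies (3.2)–(3.3); at the exit `FastTwoSum` gives (3.4).
[cite: RumpOgitaOishi2009, Lemma 3.4 (proof, eq. (3.6))] -/
theorem transformPhiAux_spec (hp : 1 ≤ p) (hfl : IsRoundNearest p emin fl) {M : ℕ} (hM : M < p)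
    {a : ℕ} (ha : a ≤ p) {n : ℕ} (hnM : n + 2 ≤ 2 ^ M) (s' : ℚ) :
    ∀ (fuel : ℕ) (t : ℚ) (k : ℤ) (xs : List ℚ), emin ≤ k → k - emin < fuel → xs.length = n →
      (∀ x ∈ xs, IsFloat p emin x ∧ |x| ≤ (2 : ℚ) ^ (k - M)) → IsFloat p emin t →
      OnGrid (unitRoundoff p * (2 : ℚ) ^ k) t → s' = t + xs.sum →
      TransformPhiSpec p emin fl M (2 ^ a * unitRoundoff p) s' n
        (transformPhiAux fl M (unitRoundoff p) (2 ^ a * unitRoundoff p) ((2 : ℚ) ^ (emin + p - 1)) fuel t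
          ((2 : ℚ) ^ k) xs).1
        (transformPhiAux fl M (unitRoundoff p) (2 ^ a * unitRoundoff p) ((2 : ℚ) ^ (emin + p - 1)) fuel t
          ((2 : ℚ) ^ k) xs).2.1
        (transformPhiAux fl M (unitRoundoff p) (2 ^ a * unitRoundoff p) ((2 : ℚ) ^ (emin + p - 1)) fuel t
          ((2 : ℚ) ^ k) xs).2.2.1
        (transformPhiAux fl M (unitRoundoff p) (2 ^ a * unitRoundoff p) ((2 : ℚ) ^ (emin + p - 1)) fuel t
          ((2 : ℚ) ^ k) xs).2.2.2
  | 0, t, k, xs, hk, hfuel, _, _, _, _, _ => absurd hfuel (by push_cast; omega)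
  | fuel + 1, t, k, xs, hk, hfuel, hlen, hxs, ht, htg, hs => by
      have hnlt : xs.length < 2 ^ M := by rw [hlen]; omega
      have hdiv : (2 : ℚ) ^ k / 2 ^ M = (2 : ℚ) ^ (k - M) := by
        rw [zpow_sub₀ (by norm_num : (2 : ℚ) ≠ 0), zpow_natCast]
      have hxs' : ∀ x ∈ xs, IsFloat p emin x ∧ |x| ≤ (2 : ℚ) ^ k / 2 ^ M := by
        intro x hx; rw [hdiv]; exact hxs x hx
      obtain ⟨hsum, hlo, hτabs, hnσ, hτg, -, hτF⟩ := extractVector_eft hp hfl hk hM hxs' hnlt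
      have hτlt : |(extractVector fl ((2 : ℚ) ^ k) xs).1| < (2 : ℚ) ^ k := hτabs.trans_lt hnσ
      simp only [transformPhiAux]
      set τ : ℚ := (extractVector fl ((2 : ℚ) ^ k) xs).1 with hτdef
      set xs₁ : List ℚ := (extractVector fl ((2 : ℚ) ^ k) xs).2 with hxs₁def
      have hlen₁ : xs₁.length = n := by rw [hxs₁def, length_extractVector_snd, hlen]
      have hxs₁F : ∀ x ∈ xs₁, IsFloat p emin x := isFloat_of_mem_extractVector_snd hfl _ xs
      have hupos := u_pos (p := p)
      have h2k := two_zpow_pos k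
      have hτabs' : |τ| ≤ (n : ℚ) * ((2 : ℚ) ^ k / 2 ^ M) := by rw [← hlen]; exact hτabs
      have hnσ' : (n : ℚ) * ((2 : ℚ) ^ k / 2 ^ M) < (2 : ℚ) ^ k := by rw [← hlen]; exact hnσ
      split_ifs with hstop
      · -- the loop stops: `[τ₁, τ₂] = FastTwoSum(t, τ)`
        have hft : (fast2Sum fl t τ).1 = fl (t + τ) := rfl
        -- `FastTwoSum` (Part I, Lemma 2.6): `τ₁ + τ₂ = t + τ`, `|τ₂| ≤ eps·ufp(τ₁)`
        have hF2S : (fast2Sum fl t τ).1 + (fast2Sum fl t τ).2 = t + τ ∧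
            |(fast2Sum fl t τ).2| ≤ unitRoundoff p * ufp (fast2Sum fl t τ).1 := by
          by_cases hτ0 : τ = 0
          · obtain ⟨-, h2, h3⟩ := fast2Sum_correct hp hfl ht hτF (by rw [hτ0, abs_zero]; exact abs_nonneg t)
            refine ⟨h3, ?_⟩
            rw [h2, hτ0, add_zero, fl_eq_self hfl ht, sub_self, abs_zero]
            exact mul_nonneg hupos.le (ufp_nonneg _)
          · -- `t ∈ epsσℤ = 2^(k-p)ℤ ⊆ 2eps·ufp(τ)ℤ` because `ufp(τ) ≤ 2^(k-1)`
            obtain ⟨e, he⟩ := exists_ufp_eq_two_zpow hτ0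
            have hek : e ≤ k - 1 := by
              have h1 : ufp τ ≤ (2 : ℚ) ^ (k - 1) :=
                ufp_le_two_zpow_of_abs_lt (by rwa [show k - 1 + 1 = k by ring])
              rw [he] at h1
              exact (zpow_le_zpow_iff_right₀ (by norm_num : (1 : ℚ) < 2)).mp h1
            have htg' : OnGrid (2 * unitRoundoff p * ufp τ) t := by
              rw [he, two_mul_u_mul_two_zpow]
              rw [u_mul_two_zpow] at htg
              exact htg.of_le (by omega)
            obtain ⟨-, -, h3, h4, h5⟩ := fastTwoSum_eft hp hfl ht hτF htg'
            exact ⟨h3, h4.trans h5⟩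
        refine
          { two_zpow := ⟨k, hk, rfl⟩
            length_eq := hlen₁
            low := fun x hx => ⟨hxs₁F x hx, hlo x hx⟩
            isFloat₁ := (hfl _).1
            isFloat₂ := (hfl _).1
            last := ⟨t, τ, ht, hτF, htg, hτg, hτabs', hnσ', by rw [hs, hsum]; ring, hF2S.1, hft, hF2S.2⟩
            exit := fun hσ => ?_ }
        -- (3.5): the second exit condition fails, so the first one holds, and `fl(Φσ) = Φσ`
        have hkp : emin + p ≤ k := by
          by_contra hlt
          have : (2 : ℚ) ^ k ≤ (2 : ℚ) ^ (emin + p - 1) := zpow_le_zpow_right₀ (by norm_num) (by omega)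
          exact absurd hσ (not_lt.mpr this)
        have hexact : fl (2 ^ a * unitRoundoff p * (2 : ℚ) ^ k) = 2 ^ a * unitRoundoff p * (2 : ℚ) ^ k := by
          rw [two_pow_mul_u_mul_two_zpow]
          exact fl_eq_self hfl (isFloat_two_zpow hp (by omega))
        rcases hstop with h | h
        · simpa [hexact, hft] using h
        · exact absurd hσ (not_lt.mpr h)
      · -- the loop continues with `t' = t + τ` (exact), `σ' = 2ᴹepsσ = 2^(k+M-p)`, `p' = xs₁`
        obtain ⟨hlt, hσgt⟩ := not_or.mp hstop
        have hlt : |fl (t + τ)| < fl (2 ^ a * unitRoundoff p * (2 : ℚ) ^ k) := not_le.mp hlt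
        have hσgt : (2 : ℚ) ^ (emin + p - 1) < (2 : ℚ) ^ k := not_le.mp hσgt
        have hkp : emin + p ≤ k := by
          by_contra hlt'
          have : (2 : ℚ) ^ k ≤ (2 : ℚ) ^ (emin + p - 1) := zpow_le_zpow_right₀ (by norm_num) (by omega)
          exact absurd hσgt (not_lt.mpr this)
        -- "no rounding error occurred in the computation of `Φσ`" (`eps ≤ Φ`, `σ ≥ eps⁻¹eta`)
        have hρ : fl (2 ^ a * unitRoundoff p * (2 : ℚ) ^ k) = (2 : ℚ) ^ (k + a - p) := by
          rw [two_pow_mul_u_mul_two_zpow]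
          exact fl_eq_self hfl (isFloat_two_zpow hp (by omega))
        have hσ' : fl (2 ^ M * unitRoundoff p * (2 : ℚ) ^ k) = (2 : ℚ) ^ (k + M - p) := by
          rw [two_pow_mul_u_mul_two_zpow]
          exact fl_eq_self hfl (isFloat_two_zpow hp (by omega))
        -- (3.6): `t' = fl(t + τ) = t + τ` as `|fl(t + τ)| < Φσ ≤ σ` (`Φ ≤ 1`) and `t, τ ∈ F ∩ epsσℤ`
        have ht'lt : |fl (t + τ)| < (2 : ℚ) ^ k := by
          rw [hρ] at hlt
          exact hlt.trans_le (zpow_le_zpow_right₀ (by norm_num) (by omega))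
        have ht'eq : fl (t + τ) = t + τ := fl_add_eq_add_of_abs_fl_lt hp hfl ht hτF htg hτg ht'lt
        -- the invariant for the next pass, with `k' = k + M - p`
        have hk' : emin ≤ k + M - p := by omega
        have hfuel' : k + M - p - emin < fuel := by push_cast at hfuel ⊢; omega
        have hxs₁' : ∀ x ∈ xs₁, IsFloat p emin x ∧ |x| ≤ (2 : ℚ) ^ (k + M - p - M) := by
          intro x hx
          refine ⟨hxs₁F x hx, ?_⟩
          have := hlo x hx
          rwa [u_mul_two_zpow, show k - (p : ℤ) = k + M - p - M by ring] at this
        have ht'g : OnGrid (unitRoundoff p * (2 : ℚ) ^ (k + M - p)) (fl (t + τ)) := by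
          rw [ht'eq, u_mul_two_zpow]
          have := htg.add hτg
          rw [u_mul_two_zpow] at this
          exact this.of_le (by omega)
        have hs' : s' = fl (t + τ) + xs₁.sum := by rw [ht'eq, hs, hsum]; ring
        have IH := transformPhiAux_spec hp hfl hM ha hnM s' fuel (fl (t + τ)) (k + M - p) xs₁ hk' hfuel'
          hlen₁ hxs₁' (hfl _).1 ht'g hs'
        rwa [hσ']

/-- **LEMMA 3.4** for Algorithm 3.3: applied to a nonzero vector `p⁽⁰⁾` of `n` floating-point numbers and
an offset `ϱ ∈ F ∩ epsσ₀ℤ`, `σ₀ = 2^(M + ⌈log₂ μ⌉)`, with `M := ⌈log₂(n + 2)⌉`, `2ᴹeps < 1`, and a parameter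
`Φ = 2ᵃeps`, `eps ≤ Φ ≤ 1`, `Transform(p⁽⁰⁾, ϱ)` stops and its results satisfy (3.2)–(3.5) (`TransformPhiSpec`)
for `s + ϱ`, `s := Σ p⁽⁰⁾ᵢ`. Entry of the loop: `μ = |p⁽⁰⁾ᵢ| ≥ eta` for some `i`, so `σ₀ ≥ eta` and
`max |p⁽⁰⁾ᵢ| = μ ≤ 2^⌈log₂ μ⌉ = 2^-M σ₀`; "the assumption `ϱ ∈ epsσ₀ℤ` assures that (3.3) is satisfied for
`m = 1`, and `t⁽⁰⁾ = ϱ` gives (3.2) for `m = 1`". [cite: RumpOgitaOishi2009, Lemma 3.4] -/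
theorem transformPhi_spec (hp : 1 ≤ p) (hfl : IsRoundNearest p emin fl) {xs : List ℚ}
    (hxs : ∀ x ∈ xs, IsFloat p emin x) (hne : maxAbs xs ≠ 0) (hM : Nat.clog 2 (xs.length + 2) < p)
    {a : ℕ} (ha : a ≤ p) {ϱ : ℚ} (hϱ : IsFloat p emin ϱ)
    (hϱg : OnGrid (unitRoundoff p * (2 : ℚ) ^ ((Nat.clog 2 (xs.length + 2) : ℤ) + Int.clog 2 (maxAbs xs))) ϱ) :
    TransformPhiSpec p emin fl (Nat.clog 2 (xs.length + 2)) (2 ^ a * unitRoundoff p) (xs.sum + ϱ) xs.length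
      (transformPhi fl p emin (2 ^ a * unitRoundoff p) xs ϱ).1
      (transformPhi fl p emin (2 ^ a * unitRoundoff p) xs ϱ).2.1
      (transformPhi fl p emin (2 ^ a * unitRoundoff p) xs ϱ).2.2.1
      (transformPhi fl p emin (2 ^ a * unitRoundoff p) xs ϱ).2.2.2 := by
  have hnM : xs.length + 2 ≤ 2 ^ Nat.clog 2 (xs.length + 2) := Nat.le_pow_clog (by norm_num) _
  -- `μ = |pᵢ| ≥ eta` for a nonzero float `pᵢ`, hence `⌈log₂ μ⌉ ≥ emin`
  obtain ⟨x, hx, hxμ⟩ := exists_abs_eq_maxAbs hne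
  have hx0 : x ≠ 0 := by intro h; rw [h, abs_zero] at hxμ; exact hne hxμ.symm
  have hμeta : (2 : ℚ) ^ emin ≤ maxAbs xs := hxμ ▸ two_zpow_emin_le_abs (hxs x hx) hx0
  have hμK : maxAbs xs ≤ (2 : ℚ) ^ Int.clog 2 (maxAbs xs) := by
    have := Int.self_le_zpow_clog (R := ℚ) (b := 2) (by norm_num) (maxAbs xs); exact_mod_cast this
  have heminK : emin ≤ Int.clog 2 (maxAbs xs) := by
    have h1 := Int.clog_mono_right (b := 2) (two_zpow_pos emin) hμeta
    have h2 : Int.clog 2 ((2 : ℚ) ^ emin) = emin := by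
      have := Int.clog_zpow (R := ℚ) (b := 2) (by norm_num) emin; exact_mod_cast this
    rwa [h2] at h1
  rw [transformPhi, if_neg hne]
  exact transformPhiAux_spec hp hfl hM ha hnM (xs.sum + ϱ) _ ϱ _ xs (by omega) (by omega) rfl
    (fun y hy => ⟨hxs y hy, by
      rw [show ((Nat.clog 2 (xs.length + 2) : ℤ) + Int.clog 2 (maxAbs xs) - (Nat.clog 2 (xs.length + 2) : ℤ))
          = Int.clog 2 (maxAbs xs) by ring]
      exact (abs_le_maxAbs hy).trans hμK⟩)
    hϱ hϱg (add_comm _ _)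

/-- LEMMA 3.4, eq. (3.4) and "`τ₁, τ₂ ∈ epsσℤ`": for results satisfying `TransformPhiSpec`,
`fl(τ₁ + τ₂) = τ₁` and `τ₁, τ₂ ∈ epsσℤ` (from `t, τ ∈ F ∩ epsσℤ`, Part I eq. (2.21)).
[cite: RumpOgitaOishi2009, Lemma 3.4 eq. (3.4) / Lemma 3.5 eq. (3.9)] -/
theorem TransformPhiSpec.fl_add_eq (hp : 1 ≤ p) (hfl : IsRoundNearest p emin fl) {M : ℕ} {Φ s' : ℚ}
    {n : ℕ} {τ₁ τ₂ σ : ℚ} {xs' : List ℚ} (H : TransformPhiSpec p emin fl M Φ s' n τ₁ τ₂ xs' σ) :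
    fl (τ₁ + τ₂) = τ₁ ∧ OnGrid (unitRoundoff p * σ) τ₁ ∧ OnGrid (unitRoundoff p * σ) τ₂ := by
  obtain ⟨k, hk, hσk⟩ := H.two_zpow
  obtain ⟨t, τ, htF, hτF, htg, hτg, -, -, -, h12, h1, -⟩ := H.last
  have hτ₁g : OnGrid (unitRoundoff p * σ) τ₁ := by
    rw [hσk] at htg hτg ⊢
    rw [h1]
    exact (onGrid_fl_add hp hfl htg hτg).1
  have hτ₂g : OnGrid (unitRoundoff p * σ) τ₂ := by
    have : τ₂ = t + τ - τ₁ := by rw [← h12]; ring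
    rw [this]
    exact (htg.add hτg).sub hτ₁g
  exact ⟨by rw [h12, ← h1], hτ₁g, hτ₂g⟩

/-- LEMMA 3.4: "if `σₘ₋₁ ≤ ½eps⁻¹eta` is satisfied for the final value of `m`, then the vector `p⁽ᵐ⁾` is
entirely zero" ((3.3) gives `|p⁽ᵐ⁾ᵢ| ≤ ½eta`), and then `s + ϱ = τ₁ + τ₂`.
[cite: RumpOgitaOishi2009, Lemma 3.4 (the case σₘ₋₁ ≤ ½eps⁻¹eta)] -/
theorem TransformPhiSpec.eq_zero_of_le {M : ℕ} {Φ s' : ℚ} {n : ℕ} {τ₁ τ₂ σ : ℚ} {xs' : List ℚ}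
    (H : TransformPhiSpec p emin fl M Φ s' n τ₁ τ₂ xs' σ) (hσ : σ ≤ (2 : ℚ) ^ (emin + p - 1)) :
    (∀ x ∈ xs', x = 0) ∧ s' = τ₁ + τ₂ := by
  obtain ⟨t, τ, -, -, -, -, -, -, hs, h12, -, -⟩ := H.last
  have hzero : ∀ x ∈ xs', x = 0 := by
    intro x hx
    obtain ⟨hxF, hxle⟩ := H.low x hx
    refine eq_zero_of_isFloat_of_abs_lt hxF (hxle.trans_lt ?_)
    calc unitRoundoff p * σ ≤ unitRoundoff p * (2 : ℚ) ^ (emin + p - 1) :=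
          mul_le_mul_of_nonneg_left hσ u_pos.le
      _ = (2 : ℚ) ^ (emin - 1) := by rw [u_mul_two_zpow]; congr 1; ring
      _ < (2 : ℚ) ^ emin := zpow_lt_zpow_right₀ (by norm_num) (by omega)
  exact ⟨hzero, by rw [hs, List.sum_eq_zero hzero, add_zero, h12]⟩

/-- LEMMA 3.4, eq. (3.5): if `σₘ₋₁ > ½eps⁻¹eta` for the final `m` then `ufp(τ₁) ≥ Φσₘ₋₁` (`Φσ = 2^(k+a−p)` is
a power of two below `|τ₁|`). [cite: RumpOgitaOishi2009, Lemma 3.4 eq. (3.5)] -/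
theorem TransformPhiSpec.phi_mul_le_ufp {M a : ℕ} {s' : ℚ} {n : ℕ} {τ₁ τ₂ σ : ℚ} {xs' : List ℚ}
    (H : TransformPhiSpec p emin fl M (2 ^ a * unitRoundoff p) s' n τ₁ τ₂ xs' σ)
    (hσ : (2 : ℚ) ^ (emin + p - 1) < σ) : 2 ^ a * unitRoundoff p * σ ≤ ufp τ₁ := by
  obtain ⟨k, -, hσk⟩ := H.two_zpow
  have h := H.exit hσ
  rw [hσk, two_pow_mul_u_mul_two_zpow] at h ⊢
  exact two_zpow_le_ufp h

/-- LEMMA 3.4, eq. (3.3) as printed: `|τ⁽ᵐ⁾| ≤ (1 − 2⁻ᴹ)σₘ₋₁ < σₘ₋₁` (from `|τ⁽ᵐ⁾| ≤ n·2⁻ᴹσₘ₋₁` and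
`n + 2 ≤ 2ᴹ`; in fact `≤ (1 − 2^(1−M))σₘ₋₁`). [cite: RumpOgitaOishi2009, Lemma 3.4 eq. (3.3)] -/
theorem TransformPhiSpec.last_printed {M : ℕ} {Φ s' : ℚ} {n : ℕ} {τ₁ τ₂ σ : ℚ} {xs' : List ℚ}
    (H : TransformPhiSpec p emin fl M Φ s' n τ₁ τ₂ xs' σ) (hnM : n + 2 ≤ 2 ^ M) :
    ∃ t τ : ℚ, |τ| ≤ (1 - 1 / 2 ^ M) * σ ∧ (1 - 1 / 2 ^ M) * σ < σ ∧ s' = t + τ + xs'.sum ∧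
      τ₁ + τ₂ = t + τ ∧ τ₁ = fl (t + τ) := by
  obtain ⟨k, -, hσk⟩ := H.two_zpow
  obtain ⟨t, τ, -, -, -, -, hτle, -, hs, h12, h1, -⟩ := H.last
  have hσ0 : 0 < σ := hσk ▸ two_zpow_pos k
  have hm0 : (0 : ℚ) < 2 ^ M := by positivity
  have hnm : (n : ℚ) + 2 ≤ 2 ^ M := by exact_mod_cast hnM
  refine ⟨t, τ, hτle.trans ?_, ?_, hs, h12, h1⟩
  · rw [show (n : ℚ) * (σ / 2 ^ M) = (n / 2 ^ M) * σ by ring]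
    refine mul_le_mul_of_nonneg_right ?_ hσ0.le
    rw [div_le_iff₀ hm0, sub_mul, one_mul, one_div_mul_cancel hm0.ne']
    linarith only [hnm]
  · have : (0 : ℚ) < 1 / 2 ^ M * σ := by positivity
    linarith only [this]

/-! ### §3, Lemma 3.5: `res = fl(τ₁ + (τ₂ + Σ p′ᵢ))` after `Transform(p, ϱ)` with `Φ = 2²ᴹeps` -/

/-- The code (3.7): `[τ₁, τ₂, p′, σ] = Transform(p, ϱ)` with the parameter `Φ` replaced by `2²ᴹeps`,
`res = fl(τ₁ + (τ₂ + Σ p′ᵢ))` (the inner sum by ordinary recursive summation `flSum`; "the code in (3.7)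
without offset is the same as for Algorithm 4.5 (`AccSum`) in Part I", `accSumOffset_zero`).
[cite: RumpOgitaOishi2009, Lemma 3.5 eq. (3.7)] -/
def accSumOffset (fl : ℚ → ℚ) (p : ℕ) (emin : ℤ) (xs : List ℚ) (ϱ : ℚ) : ℚ :=
  fl ((transformPhi fl p emin (2 ^ (2 * Nat.clog 2 (xs.length + 2)) * unitRoundoff p) xs ϱ).1 +
    fl ((transformPhi fl p emin (2 ^ (2 * Nat.clog 2 (xs.length + 2)) * unitRoundoff p) xs ϱ).2.1 +
      flSum fl (transformPhi fl p emin (2 ^ (2 * Nat.clog 2 (xs.length + 2)) * unitRoundoff p) xs ϱ).2.2.1))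

/-- "The code in (3.7) without offset is the same as for Algorithm 4.5 (`AccSum`) in Part I."
[cite: RumpOgitaOishi2009, Lemma 3.5 (remark before it)] -/
theorem accSumOffset_zero (fl : ℚ → ℚ) (p : ℕ) (emin : ℤ) (xs : List ℚ) :
    accSumOffset fl p emin xs 0 = accSum fl p emin xs := by
  rw [accSumOffset, transformPhi_two_pow_two_mul_zero, accSum]

/-- On the zero vector the code (3.7) returns `res = fl(ϱ + fl(0 + 0)) = ϱ = s + ϱ` for `ϱ ∈ F`.
[cite: RumpOgitaOishi2009, Algorithm 3.3 ("if μ = 0") / Lemma 3.5 eq. (3.7)] -/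
theorem accSumOffset_of_maxAbs_eq_zero (hfl : IsRoundNearest p emin fl) {xs : List ℚ} (h : maxAbs xs = 0)
    {ϱ : ℚ} (hϱ : IsFloat p emin ϱ) : accSumOffset fl p emin xs ϱ = ϱ ∧ xs.sum = 0 := by
  have hz := maxAbs_eq_zero_iff.mp h
  refine ⟨?_, List.sum_eq_zero hz⟩
  rw [accSumOffset, transformPhi_of_maxAbs_eq_zero fl p emin _ ϱ h]
  simp only [flSum_eq_zero hfl hz, fl_eq_self hfl (isFloat_zero p emin), add_zero, fl_eq_self hfl hϱ]

/-- **LEMMA 3.5.** Let `p` be a nonzero vector of `n` floating-point numbers and `ϱ ∈ F ∩ epsσ₀ℤ`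
(`σ₀ = 2^(M + ⌈log₂ μ⌉)`, `μ = max |pᵢ|`), `M := ⌈log₂(n + 2)⌉`, `2²ᴹeps ≤ 1`, and let `[τ₁, τ₂, p′, σ] = Transform(p, ϱ)`
with `Φ = 2²ᴹeps`, `res = fl(τ₁ + (τ₂ + Σ p′ᵢ))` (3.7). Then `res` is a faithful rounding of `s + ϱ`, `s := Σ pᵢ`;
"if `res = 0`, then `s + ϱ = τ₁ = τ₂ = 0` and all components of the vector `p′` are zero"; and for `res ≠ 0`
(3.10) `|s + ϱ − res| < 2eps(1 − 2^(−M−1))ufp(res)` (for `res = 0`, `s + ϱ = res` exactly and (3.10) as printed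
would read `0 < 0`). Proof as in the source: Part I, Lemma 4.3 (`faithful_of_transformSpec_tree`) over the
assertions of Lemma 3.4, "basically `s` has to be replaced by `s + ϱ`".
[cite: RumpOgitaOishi2009, Lemma 3.5 eq. (3.10)] -/
theorem accSumOffset_spec_of_maxAbs_ne_zero (hfl : IsRoundNearest p emin fl) {xs : List ℚ}
    (hxs : ∀ x ∈ xs, IsFloat p emin x) (hne : maxAbs xs ≠ 0) (h2M : 2 * Nat.clog 2 (xs.length + 2) ≤ p)
    {ϱ : ℚ} (hϱ : IsFloat p emin ϱ)
    (hϱg : OnGrid (unitRoundoff p * (2 : ℚ) ^ ((Nat.clog 2 (xs.length + 2) : ℤ) + Int.clog 2 (maxAbs xs))) ϱ) :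
    IsFaithfulRounding p emin (accSumOffset fl p emin xs ϱ) (xs.sum + ϱ) ∧
      (accSumOffset fl p emin xs ϱ = 0 →
        (transformPhi fl p emin (2 ^ (2 * Nat.clog 2 (xs.length + 2)) * unitRoundoff p) xs ϱ).1 = 0 ∧
        (transformPhi fl p emin (2 ^ (2 * Nat.clog 2 (xs.length + 2)) * unitRoundoff p) xs ϱ).2.1 = 0 ∧
        (∀ x ∈ (transformPhi fl p emin (2 ^ (2 * Nat.clog 2 (xs.length + 2)) * unitRoundoff p) xs ϱ).2.2.1,
          x = 0) ∧ xs.sum + ϱ = 0) ∧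
      (accSumOffset fl p emin xs ϱ ≠ 0 → |xs.sum + ϱ - accSumOffset fl p emin xs ϱ| <
        2 * unitRoundoff p * (1 - 1 / 2 ^ (Nat.clog 2 (xs.length + 2) + 1)) *
          ufp (accSumOffset fl p emin xs ϱ)) := by
  have hnil : xs ≠ [] := by rintro rfl; exact hne rfl
  have hM : 2 ≤ Nat.clog 2 (xs.length + 2) := two_le_clog_length_add_two hnil
  have hp : 1 ≤ p := by omega
  have hn : 1 ≤ xs.length := by
    cases xs with
    | nil => exact absurd rfl hnil
    | cons _ _ => simp
  have hnM : xs.length + 2 ≤ 2 ^ Nat.clog 2 (xs.length + 2) := Nat.le_pow_clog (by norm_num) _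
  have H := (transformPhi_spec hp hfl hxs hne (by omega) h2M hϱ hϱg).toTransformSpec
  have hnil' : (transformPhi fl p emin (2 ^ (2 * Nat.clog 2 (xs.length + 2)) * unitRoundoff p) xs ϱ).2.2.1
      ≠ [] := by
    intro h
    have h1 := H.length_eq
    rw [h, List.length_nil] at h1
    omega
  obtain ⟨t₃, ht₃, hft⟩ := exists_tree_flSum fl hnil'
  have := faithful_of_transformSpec_tree hfl hM h2M hn hnM H t₃ ht₃
  rw [accSumOffset, hft]
  exact this

/-- **LEMMA 3.5 (faithfulness), all cases:** under the hypotheses of Lemma 3.5 on `ϱ` the result `res` of (3.7)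
is a faithful rounding of `s + ϱ` — for the zero vector trivially (`res = ϱ = s + ϱ`).
[cite: RumpOgitaOishi2009, Lemma 3.5] -/
theorem isFaithfulRounding_accSumOffset (hfl : IsRoundNearest p emin fl) {xs : List ℚ}
    (hxs : ∀ x ∈ xs, IsFloat p emin x) (h2M : 2 * Nat.clog 2 (xs.length + 2) ≤ p) {ϱ : ℚ}
    (hϱ : IsFloat p emin ϱ)
    (hϱg : OnGrid (unitRoundoff p * (2 : ℚ) ^ ((Nat.clog 2 (xs.length + 2) : ℤ) + Int.clog 2 (maxAbs xs))) ϱ) :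
    IsFaithfulRounding p emin (accSumOffset fl p emin xs ϱ) (xs.sum + ϱ) := by
  by_cases hμ : maxAbs xs = 0
  · obtain ⟨h1, h2⟩ := accSumOffset_of_maxAbs_eq_zero hfl hμ hϱ
    rw [h1, h2, zero_add]
    have := isFaithfulRounding_fl hfl ϱ
    rwa [fl_eq_self hfl hϱ] at this
  · exact (accSumOffset_spec_of_maxAbs_ne_zero hfl hxs hμ h2M hϱ hϱg).1

/-- **LEMMA 3.5, eqs. (3.8), (3.9), (3.11)** and its two zero clauses on `Transform`: for
`[τ₁, τ₂, p′, σ] = Transform(p, ϱ)` with `Φ = 2²ᴹeps` (nonzero `p`, `ϱ ∈ F ∩ epsσ₀ℤ`, `2²ᴹeps ≤ 1`):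
(3.8) `s + ϱ = τ₁ + τ₂ + Σ p′ᵢ`, `max |p′ᵢ| ≤ epsσ`; (3.9) `fl(τ₁ + τ₂) = τ₁`, `τ₁, τ₂ ∈ epsσℤ`, `|τ₂| ≤ eps·ufp(τ₁)`;
(3.11) `σ > ½eps⁻¹eta ⟹ ufp(τ₁) ≥ 2²ᴹepsσ`; and "if `σ ≤ ½eps⁻¹eta`, then all components of the vector `p′` are
zero and `s + ϱ = τ₁ + τ₂`". [cite: RumpOgitaOishi2009, Lemma 3.5 eqs. (3.8), (3.9), (3.11)] -/
theorem transformPhi_eqs (hfl : IsRoundNearest p emin fl) {xs : List ℚ}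
    (hxs : ∀ x ∈ xs, IsFloat p emin x) (hne : maxAbs xs ≠ 0) (h2M : 2 * Nat.clog 2 (xs.length + 2) ≤ p)
    {ϱ : ℚ} (hϱ : IsFloat p emin ϱ)
    (hϱg : OnGrid (unitRoundoff p * (2 : ℚ) ^ ((Nat.clog 2 (xs.length + 2) : ℤ) + Int.clog 2 (maxAbs xs))) ϱ) :
    xs.sum + ϱ = (transformPhi fl p emin (2 ^ (2 * Nat.clog 2 (xs.length + 2)) * unitRoundoff p) xs ϱ).1 +
        (transformPhi fl p emin (2 ^ (2 * Nat.clog 2 (xs.length + 2)) * unitRoundoff p) xs ϱ).2.1 +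
        (transformPhi fl p emin (2 ^ (2 * Nat.clog 2 (xs.length + 2)) * unitRoundoff p) xs ϱ).2.2.1.sum ∧
      (∀ x ∈ (transformPhi fl p emin (2 ^ (2 * Nat.clog 2 (xs.length + 2)) * unitRoundoff p) xs ϱ).2.2.1,
        |x| ≤ unitRoundoff p *
          (transformPhi fl p emin (2 ^ (2 * Nat.clog 2 (xs.length + 2)) * unitRoundoff p) xs ϱ).2.2.2) ∧
      fl ((transformPhi fl p emin (2 ^ (2 * Nat.clog 2 (xs.length + 2)) * unitRoundoff p) xs ϱ).1 +
          (transformPhi fl p emin (2 ^ (2 * Nat.clog 2 (xs.length + 2)) * unitRoundoff p) xs ϱ).2.1) =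
        (transformPhi fl p emin (2 ^ (2 * Nat.clog 2 (xs.length + 2)) * unitRoundoff p) xs ϱ).1 ∧
      OnGrid (unitRoundoff p *
          (transformPhi fl p emin (2 ^ (2 * Nat.clog 2 (xs.length + 2)) * unitRoundoff p) xs ϱ).2.2.2)
        (transformPhi fl p emin (2 ^ (2 * Nat.clog 2 (xs.length + 2)) * unitRoundoff p) xs ϱ).1 ∧
      OnGrid (unitRoundoff p *
          (transformPhi fl p emin (2 ^ (2 * Nat.clog 2 (xs.length + 2)) * unitRoundoff p) xs ϱ).2.2.2)
        (transformPhi fl p emin (2 ^ (2 * Nat.clog 2 (xs.length + 2)) * unitRoundoff p) xs ϱ).2.1 ∧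
      |(transformPhi fl p emin (2 ^ (2 * Nat.clog 2 (xs.length + 2)) * unitRoundoff p) xs ϱ).2.1| ≤
        unitRoundoff p *
          ufp (transformPhi fl p emin (2 ^ (2 * Nat.clog 2 (xs.length + 2)) * unitRoundoff p) xs ϱ).1 ∧
      ((2 : ℚ) ^ (emin + p - 1) <
          (transformPhi fl p emin (2 ^ (2 * Nat.clog 2 (xs.length + 2)) * unitRoundoff p) xs ϱ).2.2.2 →
        2 ^ (2 * Nat.clog 2 (xs.length + 2)) * unitRoundoff p *
            (transformPhi fl p emin (2 ^ (2 * Nat.clog 2 (xs.length + 2)) * unitRoundoff p) xs ϱ).2.2.2 ≤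
          ufp (transformPhi fl p emin (2 ^ (2 * Nat.clog 2 (xs.length + 2)) * unitRoundoff p) xs ϱ).1) ∧
      ((transformPhi fl p emin (2 ^ (2 * Nat.clog 2 (xs.length + 2)) * unitRoundoff p) xs ϱ).2.2.2 ≤
          (2 : ℚ) ^ (emin + p - 1) →
        (∀ x ∈ (transformPhi fl p emin (2 ^ (2 * Nat.clog 2 (xs.length + 2)) * unitRoundoff p) xs ϱ).2.2.1,
          x = 0) ∧
        xs.sum + ϱ = (transformPhi fl p emin (2 ^ (2 * Nat.clog 2 (xs.length + 2)) * unitRoundoff p) xs ϱ).1 +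
          (transformPhi fl p emin (2 ^ (2 * Nat.clog 2 (xs.length + 2)) * unitRoundoff p) xs ϱ).2.1) := by
  have hp : 1 ≤ p := le_trans (one_le_clog_length_add_two xs) (by omega)
  have H := transformPhi_spec hp hfl hxs hne (by omega) h2M hϱ hϱg
  obtain ⟨h1, h2, h3, h4, h5, h6, h7⟩ := H.toTransformSpec.eqs hp hfl
  exact ⟨h1, h2, h3, h4, h5, h6, h7, fun hσ => H.eq_zero_of_le hσ⟩

/-- **LEMMA 3.5, eqs. (3.12)–(3.17)**, over the assertions of Part I, Lemma 4.2 / Lemma 3.4 with `Φ = 2²ᴹeps`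
(`TransformSpec` for the sum `s' = s + ϱ` of `n ≥ 1` terms, `M ≥ 2`, `n + 2 ≤ 2ᴹ`, `2²ᴹeps ≤ 1`) in the case
`σ > ½eps⁻¹eta`, for ANY floating-point evaluation `τ₃` of `Σ p′ᵢ` with (3.14) `|τ₃| ≤ n·epsσ` and Part I (2.20)
`|τ₃ − Σ p′ᵢ| ≤ ½n(n−1)eps·epsσ`: with (3.12) `τ₂′ = fl(τ₂ + τ₃)`, `res = fl(τ₁ + τ₂′)` and (3.13) `r := τ₁ + τ₂′`,
`δ := s' − r` (`= δ₂ + δ₃`), one has (3.15) `|τ₂′| ≤ (1 + eps)|τ₂ + τ₃|`, `|τ₂ + τ₃| ≤ eps·ufp(τ₁) + n·epsσ`,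
`(1 + eps)(eps·ufp(τ₁) + n·epsσ) < |τ₁|`; (3.16) `|res| ≥ ⅝|τ₁|`; (3.17) `2eps⁻¹|δ| < (1 − 2⁻ᴹ)|res| < |res|`
("the remaining assertions (3.14) through (3.17) repeat corresponding assertions in the proof of Lemma 4.3 in
Part I"; the comparison behind (3.17) is Part I (4.21), strict via `n ≥ 1`).
[cite: RumpOgitaOishi2009, Lemma 3.5 eqs. (3.12)–(3.17)] -/
theorem estimates_of_transformSpec (hfl : IsRoundNearest p emin fl) {M : ℕ} (hM : 2 ≤ M)
    (h2M : 2 * M ≤ p) {n : ℕ} (hn : 1 ≤ n) (hnM : n + 2 ≤ 2 ^ M) {s' τ₁ τ₂ σ : ℚ} {xs' : List ℚ}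
    (H : TransformSpec p emin fl M s' n τ₁ τ₂ xs' σ) (hσN : (2 : ℚ) ^ (emin + p - 1) < σ) {τ₃ : ℚ}
    (hτ₃F : IsFloat p emin τ₃) (hτ₃abs : |τ₃| ≤ n * (unitRoundoff p * σ))
    (hτ₃err : |τ₃ - xs'.sum| ≤ ((n : ℚ) * ((n : ℚ) - 1) / 2) * (unitRoundoff p * (unitRoundoff p * σ))) :
    |fl (τ₂ + τ₃)| ≤ (1 + unitRoundoff p) * |τ₂ + τ₃| ∧
      |τ₂ + τ₃| ≤ unitRoundoff p * ufp τ₁ + n * (unitRoundoff p * σ) ∧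
      (1 + unitRoundoff p) * (unitRoundoff p * ufp τ₁ + n * (unitRoundoff p * σ)) < |τ₁| ∧
      5 / 8 * |τ₁| ≤ |fl (τ₁ + fl (τ₂ + τ₃))| ∧
      2 / unitRoundoff p * |s' - (τ₁ + fl (τ₂ + τ₃))| < (1 - 1 / 2 ^ M) * |fl (τ₁ + fl (τ₂ + τ₃))| ∧
      (1 - 1 / 2 ^ M) * |fl (τ₁ + fl (τ₂ + τ₃))| < |fl (τ₁ + fl (τ₂ + τ₃))| := by
  have hp : 1 ≤ p := by omega
  obtain ⟨k, hk, hσk⟩ := H.two_zpow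
  obtain ⟨t, τ, htF, hτF, htg, hτg, hτlt, hs, h12, h1, hτ₂le⟩ := H.last
  have hτ₁F := H.isFloat₁
  have hτ₂F := H.isFloat₂
  have hu0 : 0 < unitRoundoff p := u_pos
  /- Atoms as in Part I: `u = eps`, `e = epsσ`, `A = ufp(τ₁)`, `T = |τ₁|`, `m = 2ᴹ`, `Q = |τ₂ + τ₃|`. -/
  set u := unitRoundoff p with hu
  set e := u * σ with he
  set A := ufp τ₁ with hA
  set T := |τ₁| with hT
  set m : ℚ := (2 : ℚ) ^ M with hm
  have he0 : 0 < e := mul_pos hu0 (hσk ▸ two_zpow_pos k)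
  have hm0 : 0 < m := by positivity
  have hm4 : 4 ≤ m := by
    calc (4 : ℚ) = 2 ^ 2 := by norm_num
      _ ≤ 2 ^ M := pow_le_pow_right₀ (by norm_num) hM
  have hnm : (n : ℚ) + 2 ≤ m := by rw [hm]; exact_mod_cast hnM
  have hn1 : (1 : ℚ) ≤ n := by exact_mod_cast hn
  -- `2ᴹ⁺²eps ≤ 1` from `M + 2 ≤ 2M ≤ p`
  have h4um : 4 * u * m ≤ 1 := by
    have h1 : (2 : ℚ) ^ (M + 2) ≤ 2 ^ p := pow_le_pow_right₀ (by norm_num) (by omega)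
    have h2 : (0 : ℚ) < 2 ^ p := by positivity
    rw [pow_add] at h1
    rw [hu, hm, unitRoundoff, show 4 * (1 / (2 : ℚ) ^ p) * 2 ^ M = (2 ^ M * 2 ^ 2) / 2 ^ p by ring,
      div_le_one h2]
    exact h1
  -- (3.11): `A = ufp(τ₁) ≥ 2²ᴹepsσ = m²e`
  have hρA : m * m * e ≤ A := by
    have h1 := H.exit hσN
    rw [hσk, two_pow_mul_u_mul_two_zpow] at h1
    have h2 := two_zpow_le_ufp h1
    rw [← two_pow_mul_u_mul_two_zpow, ← hσk, two_mul, pow_add] at h2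
    have h3 : m * m * e = 2 ^ M * 2 ^ M * unitRoundoff p * σ := by rw [hm, he, hu]; ring
    rw [h3]; exact h2
  have hA0 : 0 < A := lt_of_lt_of_le (by positivity) hρA
  have hτ₁0 : τ₁ ≠ 0 := by intro h; rw [hA, h, ufp_zero] at hA0; exact lt_irrefl _ hA0
  have hAT : A ≤ T := ufp_le_abs τ₁
  have hT0 : 0 < T := lt_of_lt_of_le hA0 hAT
  set Q := |τ₂ + τ₃| with hQ
  have hQle : Q ≤ u * A + n * e := (abs_add_le τ₂ τ₃).trans (add_le_add hτ₂le hτ₃abs)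
  -- `τ₂′ = fl(τ₂ + τ₃)`: `|τ₂′ − (τ₂ + τ₃)| ≤ eps·|τ₂ + τ₃|`
  set τ₂' := fl (τ₂ + τ₃) with hτ₂'
  have hτ₂'F : IsFloat p emin τ₂' := (hfl _).1
  have hd₂ : |τ₂' - (τ₂ + τ₃)| ≤ u * Q :=
    (abs_fl_add_sub_le_u_ufp hp hfl hτ₂F hτ₃F).trans (mul_le_mul_of_nonneg_left (ufp_le_abs _) hu0.le)
  have hτ₂'abs : |τ₂'| ≤ Q + u * Q := by
    have : |τ₂'| ≤ |τ₂ + τ₃| + |τ₂' - (τ₂ + τ₃)| := by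
      calc |τ₂'| = |(τ₂ + τ₃) + (τ₂' - (τ₂ + τ₃))| := by ring_nf
        _ ≤ |τ₂ + τ₃| + |τ₂' - (τ₂ + τ₃)| := abs_add_le _ _
    linarith only [this, hd₂]
  -- `res = fl(r)`, `r = τ₁ + τ₂′`: `|res − r| ≤ eps·ufp(r) ≤ eps|r|`
  set r := τ₁ + τ₂' with hr
  have hres_r : |fl r - r| ≤ u * ufp r := abs_fl_add_sub_le_u_ufp hp hfl hτ₁F hτ₂'F
  have hres_r' : |fl r - r| ≤ u * |r| := hres_r.trans (mul_le_mul_of_nonneg_left (ufp_le_abs r) hu0.le)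
  have hr_ge : T ≤ |r| + |τ₂'| := by
    calc T = |r + -τ₂'| := by rw [hT, hr]; ring_nf
      _ ≤ |r| + |-τ₂'| := abs_add_le _ _
      _ = |r| + |τ₂'| := by rw [abs_neg]
  have hres_ge : |r| - u * |r| ≤ |fl r| := by
    have := abs_sub_abs_le_abs_sub r (fl r)
    rw [abs_sub_comm] at this
    linarith only [this, hres_r']
  have hu16 : u ≤ 1 / 16 := by
    have : 4 * u * 4 ≤ 4 * u * m := mul_le_mul_of_nonneg_left hm4 (by positivity)
    linarith only [this, h4um]
  -- Part I (4.17): `|res| ≥ (1 − 2eps)|τ₁| − n·epsσ`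
  have hR1 : (1 - 2 * u) * T - n * e ≤ |fl r| := by
    have Pa : 0 ≤ (1 - u) * (|r| + |τ₂'| - T) :=
      mul_nonneg (by linarith only [hu16]) (by linarith only [hr_ge])
    have Pb : 0 ≤ (1 - u) * ((1 + u) * Q - |τ₂'|) :=
      mul_nonneg (by linarith only [hu16]) (by linarith only [hτ₂'abs])
    have Pc : 0 ≤ u * u * Q := by positivity
    have Pd : u * A ≤ u * T := mul_le_mul_of_nonneg_left hAT hu0.le
    linarith only [hres_ge, Pa, Pb, Pc, hQle, Pd]
  -- `n·epsσ ≤ (2ᴹ − 2)epsσ ≤ ufp(τ₁)/2ᴹ ≤ |τ₁|/4`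
  have hne_le : (n : ℚ) * e ≤ (m - 2) * e := mul_le_mul_of_nonneg_right (by linarith only [hnm]) he0.le
  have hme_le : 4 * ((m - 2) * e) ≤ A := by
    have h1 : 4 * ((m - 2) * e) ≤ m * ((m - 2) * e) :=
      mul_le_mul_of_nonneg_right hm4 (mul_nonneg (by linarith only [hm4]) he0.le)
    have h2 : 0 ≤ m * e := mul_nonneg hm0.le he0.le
    nlinarith only [h1, hρA, h2]
  have huA : u * A ≤ 1 / 16 * A := mul_le_mul_of_nonneg_right hu16 hA0.le
  have huT : u * T ≤ 1 / 16 * T := mul_le_mul_of_nonneg_right hu16 hT0.le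
  -- Part I (4.21), strict: `2ᴹ·eps(2eps·A + n(n+1)e) < (2ᴹ − 1)((1 − 2eps)T − ne)`
  have hG : m * (2 * u * A + n * (n + 1) * e) < (m - 1) * ((1 - 2 * u) * T - n * e) := by
    have P1 : 0 ≤ ((m - 1) * (1 - 2 * u)) * (T - A) :=
      mul_nonneg (mul_nonneg (by linarith only [hm4]) (by linarith only [hu16]))
        (by linarith only [hAT])
    have P2 : 0 ≤ (m - 1 - 4 * u * m + 2 * u) * (A - m * m * e) :=
      mul_nonneg (by linarith only [hm4, h4um, hu0]) (by linarith only [hρA])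
    have F3 : (n : ℚ) * (n + 2) ≤ (m - 2) * m :=
      mul_le_mul (by linarith only [hnm]) hnm (by linarith only [hn1]) (by linarith only [hm4])
    have P3 : 0 ≤ (m * e) * ((m - 2) * m - n * (n + 2)) :=
      mul_nonneg (mul_nonneg (by linarith only [hm4]) he0.le) (by linarith only [F3])
    have P4 : 0 ≤ (m * e * m) * (1 - 4 * u * m + 2 * u) :=
      mul_nonneg (mul_nonneg (mul_nonneg (by linarith only [hm4]) he0.le) (by linarith only [hm4]))
        (by linarith only [h4um, hu0])
    have P5 : 0 < n * e := mul_pos (by linarith only [hn1]) he0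
    linarith only [P1, P2, P3, P4, P5]
  -- (3.13): `δ = s' − r = δ₂ + δ₃`, `2|δ| ≤ eps(2eps·A + n(n+1)e)` (Part I (4.18)–(4.20))
  set δ := s' - r with hδ
  have hδeq : δ = -(τ₂' - (τ₂ + τ₃)) + -(τ₃ - xs'.sum) := by rw [hδ, hr, hs, ← h12]; ring
  have hδabs : 2 * |δ| ≤ u * (2 * u * A + n * (n + 1) * e) := by
    have h1 : |δ| ≤ |τ₂' - (τ₂ + τ₃)| + |τ₃ - xs'.sum| := by
      rw [hδeq]
      exact (abs_add_le _ _).trans (by rw [abs_neg, abs_neg])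
    have h2 : u * Q ≤ u * (u * A + n * e) := mul_le_mul_of_nonneg_left hQle hu0.le
    have h3 : ((n : ℚ) * ((n : ℚ) - 1) / 2) * (u * e) * 2 + 2 * (u * (n * e))
        = u * (n * (n + 1) * e) := by ring
    linarith only [h1, hd₂, h2, hτ₃err, h3]
  -- KEY: `2ᴹ·2|δ| < (2ᴹ − 1)·eps·|res|`
  have hKEY : m * (2 * |δ|) < u * (m - 1) * |fl r| := by
    have Pk1 : m * (2 * |δ|) ≤ m * (u * (2 * u * A + n * (n + 1) * e)) :=
      mul_le_mul_of_nonneg_left hδabs (by linarith only [hm4])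
    have Pk2 : u * (m * (2 * u * A + n * (n + 1) * e))
        < u * ((m - 1) * ((1 - 2 * u) * T - n * e)) := mul_lt_mul_of_pos_left hG hu0
    have Pk3 : u * (m - 1) * ((1 - 2 * u) * T - n * e) ≤ u * (m - 1) * |fl r| :=
      mul_le_mul_of_nonneg_left hR1 (mul_nonneg hu0.le (by linarith only [hm4]))
    have hum : u * (m * (2 * u * A + n * (n + 1) * e))
        = m * (u * (2 * u * A + n * (n + 1) * e)) := by ring
    linarith only [Pk1, Pk2, Pk3, hum]
  have hres0 : 0 < |fl r| := by
    have : 0 ≤ m * (2 * |δ|) := mul_nonneg hm0.le (by positivity)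
    have h1 : 0 < u * (m - 1) * |fl r| := lt_of_le_of_lt this hKEY
    exact pos_of_mul_pos_right h1 (mul_nonneg hu0.le (by linarith only [hm4]))
  refine ⟨?_, hQle, ?_, ?_, ?_, ?_⟩
  · -- (3.15), first inequality
    linarith only [hτ₂'abs]
  · -- (3.15), last inequality: `(1 + eps)(eps·A + ne) ≤ (17/16)(A/16 + A/4) < A ≤ T`
    have h1 : (1 + u) * (u * A + n * e) ≤ (1 + 1 / 16) * (u * A + n * e) :=
      mul_le_mul_of_nonneg_right (by linarith only [hu16]) (by positivity)
    linarith only [h1, huA, hne_le, hme_le, hAT, hA0]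
  · -- (3.16): `|res| ≥ (1 − 2eps)T − ne ≥ T − T/8 − T/4`
    linarith only [hR1, huT, hne_le, hme_le, hAT]
  · -- (3.17): divide KEY by `2ᴹeps`
    have h1 : 2 * |δ| < u * (m - 1) * |fl r| / m := by
      rw [lt_div_iff₀ hm0]; linarith only [hKEY]
    calc 2 / u * |δ| = (2 * |δ|) / u := by ring
      _ < (u * (m - 1) * |fl r| / m) / u := div_lt_div_of_pos_right h1 hu0
      _ = (1 - 1 / m) * |fl r| := by field_simp
  · have : 0 < 1 / m * |fl r| := by positivity
    linarith only [this]

/-- **LEMMA 3.5, eqs. (3.14)–(3.17)** for the code (3.7) itself (`τ₃ = fl(Σ p′ᵢ)` by recursive summation,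
`τ₂′ = fl(τ₂ + τ₃)`, `res = fl(τ₁ + τ₂′)`), nonzero `p`, `ϱ ∈ F ∩ epsσ₀ℤ`, `2²ᴹeps ≤ 1`, in the case `σ > ½eps⁻¹eta`:
(3.14) `|τ₃| ≤ n·epsσ`; (3.15) `|τ₂′| ≤ (1 + eps)|τ₂ + τ₃| ≤ (1 + eps)(eps·ufp(τ₁) + n·epsσ) < |τ₁|`;
(3.16) `|res| ≥ ⅝|τ₁|`; (3.17) `2eps⁻¹|δ| < (1 − 2⁻ᴹ)|res| < |res|` for `δ = s + ϱ − (τ₁ + τ₂′)` (3.13).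
[cite: RumpOgitaOishi2009, Lemma 3.5 eqs. (3.13)–(3.17)] -/
theorem accSumOffset_estimates (hfl : IsRoundNearest p emin fl) {xs : List ℚ}
    (hxs : ∀ x ∈ xs, IsFloat p emin x) (hne : maxAbs xs ≠ 0) (h2M : 2 * Nat.clog 2 (xs.length + 2) ≤ p)
    {ϱ : ℚ} (hϱ : IsFloat p emin ϱ)
    (hϱg : OnGrid (unitRoundoff p * (2 : ℚ) ^ ((Nat.clog 2 (xs.length + 2) : ℤ) + Int.clog 2 (maxAbs xs))) ϱ)
    (hσ : (2 : ℚ) ^ (emin + p - 1) <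
      (transformPhi fl p emin (2 ^ (2 * Nat.clog 2 (xs.length + 2)) * unitRoundoff p) xs ϱ).2.2.2) :
    let τ₁ := (transformPhi fl p emin (2 ^ (2 * Nat.clog 2 (xs.length + 2)) * unitRoundoff p) xs ϱ).1
    let τ₂ := (transformPhi fl p emin (2 ^ (2 * Nat.clog 2 (xs.length + 2)) * unitRoundoff p) xs ϱ).2.1
    let xs' := (transformPhi fl p emin (2 ^ (2 * Nat.clog 2 (xs.length + 2)) * unitRoundoff p) xs ϱ).2.2.1
    let σ := (transformPhi fl p emin (2 ^ (2 * Nat.clog 2 (xs.length + 2)) * unitRoundoff p) xs ϱ).2.2.2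
    |flSum fl xs'| ≤ xs.length * (unitRoundoff p * σ) ∧
      |fl (τ₂ + flSum fl xs')| ≤ (1 + unitRoundoff p) * |τ₂ + flSum fl xs'| ∧
      |τ₂ + flSum fl xs'| ≤ unitRoundoff p * ufp τ₁ + xs.length * (unitRoundoff p * σ) ∧
      (1 + unitRoundoff p) * (unitRoundoff p * ufp τ₁ + xs.length * (unitRoundoff p * σ)) < |τ₁| ∧
      5 / 8 * |τ₁| ≤ |accSumOffset fl p emin xs ϱ| ∧
      2 / unitRoundoff p * |xs.sum + ϱ - (τ₁ + fl (τ₂ + flSum fl xs'))| <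
        (1 - 1 / 2 ^ Nat.clog 2 (xs.length + 2)) * |accSumOffset fl p emin xs ϱ| ∧
      (1 - 1 / 2 ^ Nat.clog 2 (xs.length + 2)) * |accSumOffset fl p emin xs ϱ| <
        |accSumOffset fl p emin xs ϱ| := by
  intro τ₁ τ₂ xs' σ
  have hnil : xs ≠ [] := by rintro rfl; exact hne rfl
  have hM : 2 ≤ Nat.clog 2 (xs.length + 2) := two_le_clog_length_add_two hnil
  have hp : 1 ≤ p := by omega
  have hn : 1 ≤ xs.length := by
    cases xs with
    | nil => exact absurd rfl hnil
    | cons _ _ => simp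
  have hnM : xs.length + 2 ≤ 2 ^ Nat.clog 2 (xs.length + 2) := Nat.le_pow_clog (by norm_num) _
  have H : TransformSpec p emin fl (Nat.clog 2 (xs.length + 2)) (xs.sum + ϱ) xs.length τ₁ τ₂ xs' σ :=
    (transformPhi_spec hp hfl hxs hne (by omega) h2M hϱ hϱg).toTransformSpec
  have hnil' : xs' ≠ [] := by
    intro h
    have h1 := H.length_eq
    rw [h, List.length_nil] at h1
    omega
  obtain ⟨t₃, ht₃, hft⟩ := exists_tree_flSum fl hnil'
  obtain ⟨k, hk, hσk⟩ := H.two_zpow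
  have hleavesF : ∀ a ∈ t₃.leaves, IsFloat p emin a := fun a ha => (H.low a (ht₃ ▸ ha)).1
  have hlen : t₃.leaves.length = xs.length := by rw [ht₃, H.length_eq]
  have hnp : t₃.leaves.length ≤ 2 ^ p := by
    rw [hlen]
    exact le_trans (by omega) (Nat.pow_le_pow_right (by norm_num) (by omega : Nat.clog 2 (xs.length + 2) ≤ p))
  have hj : emin ≤ k - p := by
    by_contra hlt
    have : (2 : ℚ) ^ k ≤ (2 : ℚ) ^ (emin + p - 1) := zpow_le_zpow_right₀ (by norm_num) (by omega)
    rw [← hσk] at this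
    exact absurd hσ (not_lt.mpr this)
  have huσ : unitRoundoff p * σ = (2 : ℚ) ^ (k - p) := by rw [hσk, u_mul_two_zpow]
  have hleaves : ∀ a ∈ t₃.leaves, IsFloat p emin a ∧ |a| ≤ (2 : ℚ) ^ (k - p) :=
    fun a ha => ⟨hleavesF a ha, huσ ▸ (H.low a (ht₃ ▸ ha)).2⟩
  -- (3.14) and Part I (2.20) for `τ₃ = fl(Σ p′ᵢ)`
  have h314 : |t₃.eval fl| ≤ xs.length * (unitRoundoff p * σ) := by
    have := abs_eval_le_length_mul hp hfl hj t₃ hleaves hnp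
    rw [hlen, ← huσ] at this
    exact this
  have h220 : |t₃.eval fl - xs'.sum| ≤
      ((xs.length : ℚ) * ((xs.length : ℚ) - 1) / 2) * (unitRoundoff p * (unitRoundoff p * σ)) := by
    have := abs_eval_sub_exact_le hp hfl hj t₃ hleaves hnp
    rw [hlen, exact_eq_leaves_sum, ht₃, ← huσ] at this
    exact this
  have E := estimates_of_transformSpec hfl hM h2M hn hnM H hσ (isFloat_eval hfl t₃ hleavesF) h314 h220
  have hres : accSumOffset fl p emin xs ϱ = fl (τ₁ + fl (τ₂ + t₃.eval fl)) := by
    rw [accSumOffset, hft]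
  rw [hres, hft]
  exact ⟨h314, E⟩

/-! ### §4: the sign of a sum — Algorithm 4.1 `AccSign`, Theorem 4.2 -/

/-- **ALGORITHM 4.1 (`AccSign`): rigorous computation of `sign(Σ pᵢ)`, also for huge lengths.**
`[τ₁, τ₂, p′, σ] = Transform(p, 0)` with the parameter `Φ` replaced by `2ᴹeps` (`M = ⌈log₂(n + 2)⌉`),
`S = sign(τ₁)`. [cite: RumpOgitaOishi2009, Algorithm 4.1] -/
def accSign (fl : ℚ → ℚ) (p : ℕ) (emin : ℤ) (xs : List ℚ) : SignType :=
  SignType.sign (transformPhi fl p emin (2 ^ Nat.clog 2 (xs.length + 2) * unitRoundoff p) xs 0).1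

/-- The hypothesis `2ᴹeps < 1`, `M = ⌈log₂(n + 2)⌉`, of Theorem 4.2 in terms of the precision: `M < p`, i.e.
`n + 2 ≤ 2^(p−1)` ("applicable in single precision for dimensions up to `8.3·10⁶`, and in double precision for
dimensions up to `4.5·10¹⁵`": `2²³ − 2`, `2⁵² − 2`). [cite: RumpOgitaOishi2009, Theorem 4.2 (remark after the proof)] -/
theorem clog_lt_iff (hp : 1 ≤ p) (n : ℕ) : Nat.clog 2 (n + 2) < p ↔ n + 2 ≤ 2 ^ (p - 1) := by
  rw [show Nat.clog 2 (n + 2) < p ↔ Nat.clog 2 (n + 2) ≤ p - 1 by omega,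
    Nat.clog_le_iff_le_pow (by norm_num)]

/-- Signs agree under a perturbation smaller than the magnitude: `|b| < |a| ⟹ sign(a + b) = sign(a)`.
[cite: RumpOgitaOishi2009, Theorem 4.2 (proof, "and sign(s) = sign(τ₁) by (4.2)")] -/
theorem pos_iff_and_neg_iff_of_abs_lt {a b : ℚ} (h : |b| < |a|) :
    (0 < a + b ↔ 0 < a) ∧ (a + b < 0 ↔ a < 0) := by
  rcases lt_trichotomy a 0 with ha | ha | ha
  · rw [abs_of_neg ha] at h
    have hb := (abs_lt.mp h).2
    exact ⟨⟨fun h' => by linarith, fun h' => by linarith⟩, ⟨fun _ => ha, fun _ => by linarith⟩⟩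
  · rw [ha, abs_zero] at h
    exact absurd h (not_lt.mpr (abs_nonneg b))
  · rw [abs_of_pos ha] at h
    have hb := (abs_lt.mp h).1
    exact ⟨⟨fun _ => ha, fun _ => by linarith⟩, ⟨fun h' => by linarith, fun h' => by linarith⟩⟩

/-- `sign(fl(x)) = sign(x)` for a rounding to nearest (monotone, fixes `0`, and `fl(x) = 0 ⟹ x = 0` when `x`
is a sum of two floats whose rounded sum is one of them …) — here in the form needed: if `x = τ₁ + τ₂` with
`τ₂ ∈ F` and `fl(x) = τ₁`, then `sign(τ₁) = sign(x)`.
[cite: RumpOgitaOishi2009, Theorem 4.2 (proof, case σ ≤ ½eps⁻¹eta: "τ₁ = fl(τ₁ + τ₂) = fl(s)")] -/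
theorem pos_iff_and_neg_iff_of_fl_eq (hfl : IsRoundNearest p emin fl) {τ₁ τ₂ : ℚ}
    (hτ₂ : IsFloat p emin τ₂) (h : fl (τ₁ + τ₂) = τ₁) :
    (0 < τ₁ ↔ 0 < τ₁ + τ₂) ∧ (τ₁ < 0 ↔ τ₁ + τ₂ < 0) := by
  have h0 : τ₁ = 0 → τ₁ + τ₂ = 0 := by
    intro h1
    have : fl τ₂ = 0 := by rw [h1, zero_add] at h; exact h
    rw [fl_eq_self hfl hτ₂] at this
    rw [h1, this, add_zero]
  have hnn : 0 ≤ τ₁ + τ₂ → 0 ≤ τ₁ := fun hs => h ▸ fl_nonneg hfl hs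
  have hnp : τ₁ + τ₂ ≤ 0 → τ₁ ≤ 0 := fun hs => h ▸ fl_le_of_le hfl (isFloat_zero p emin) hs
  refine ⟨⟨fun h1 => ?_, fun h1 => ?_⟩, ⟨fun h1 => ?_, fun h1 => ?_⟩⟩
  · by_contra hle
    exact absurd (hnp (not_lt.mp hle)) (not_le.mpr h1)
  · rcases lt_or_eq_of_le (hnn h1.le) with h2 | h2
    · exact h2
    · exact absurd (h0 h2.symm) h1.ne'
  · by_contra hle
    exact absurd (hnn (not_lt.mp hle)) (not_le.mpr h1)
  · rcases lt_or_eq_of_le (hnp h1.le) with h2 | h2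
    · exact h2
    · exact absurd (h0 h2) h1.ne

/-- **THEOREM 4.2 (the sign of `τ₁`).** Let `[τ₁, τ₂, p′, σ] = Transform(p, 0)` with `Φ = 2ᴹeps` for a vector of
`n` floating-point numbers `pᵢ` with `2ᴹeps < 1`, `M := ⌈log₂(n + 2)⌉`. Then `τ₁ > 0 ⟺ s > 0`, `τ₁ < 0 ⟺ s < 0`
(and so `τ₁ = 0 ⟺ s = 0`) for `s := Σ pᵢ`. Proof as in the source: w.l.o.g. `p ≠ 0`; by Lemma 3.4 with `ϱ = 0`,
(4.2) `s = τ₁ + τ₂ + Σ p′ᵢ`; if `σ ≤ ½eps⁻¹eta` then `p′ = 0` and `τ₁ = fl(τ₁ + τ₂) = fl(s)`; if `σ > ½eps⁻¹eta`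
then `|τ₁| ≥ 2ᴹepsσ`, `|τ₂| ≤ eps|τ₁|` and (3.3) give `|τ₂| + |Σ p′ᵢ| ≤ eps|τ₁| + (2ᴹ − 2)epsσ < (1 − eps)|τ₁|`.
[cite: RumpOgitaOishi2009, Theorem 4.2 eq. (4.1) (proof, eq. (4.2))] -/
theorem transformPhi_fst_pos_iff_and_neg_iff (hfl : IsRoundNearest p emin fl) {xs : List ℚ}
    (hxs : ∀ x ∈ xs, IsFloat p emin x) (hM : Nat.clog 2 (xs.length + 2) < p) :
    (0 < (transformPhi fl p emin (2 ^ Nat.clog 2 (xs.length + 2) * unitRoundoff p) xs 0).1 ↔ 0 < xs.sum) ∧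
      ((transformPhi fl p emin (2 ^ Nat.clog 2 (xs.length + 2) * unitRoundoff p) xs 0).1 < 0 ↔ xs.sum < 0) := by
  have hp : 1 ≤ p := le_trans (one_le_clog_length_add_two xs) hM.le
  by_cases hμ : maxAbs xs = 0
  · -- the zero vector: `τ₁ = ϱ = 0 = s`
    rw [transformPhi_of_maxAbs_eq_zero fl p emin _ 0 hμ, List.sum_eq_zero (maxAbs_eq_zero_iff.mp hμ)]
    simp
  · have hnM : xs.length + 2 ≤ 2 ^ Nat.clog 2 (xs.length + 2) := Nat.le_pow_clog (by norm_num) _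
    have H := transformPhi_spec hp hfl hxs hμ hM hM.le (isFloat_zero p emin) (onGrid_zero _)
    set τ₁ := (transformPhi fl p emin (2 ^ Nat.clog 2 (xs.length + 2) * unitRoundoff p) xs 0).1 with hτ₁
    set τ₂ := (transformPhi fl p emin (2 ^ Nat.clog 2 (xs.length + 2) * unitRoundoff p) xs 0).2.1 with hτ₂
    set xs' := (transformPhi fl p emin (2 ^ Nat.clog 2 (xs.length + 2) * unitRoundoff p) xs 0).2.2.1 with hxs'
    set σ := (transformPhi fl p emin (2 ^ Nat.clog 2 (xs.length + 2) * unitRoundoff p) xs 0).2.2.2 with hσ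
    rw [add_zero] at H
    rcases le_or_gt σ ((2 : ℚ) ^ (emin + p - 1)) with hσU | hσN
    · -- `σ ≤ ½eps⁻¹eta`: `p′ = 0`, `s = τ₁ + τ₂`, `τ₁ = fl(τ₁ + τ₂) = fl(s)`
      obtain ⟨-, hs⟩ := H.eq_zero_of_le hσU
      obtain ⟨h1, -, -⟩ := H.fl_add_eq hp hfl
      rw [hs]
      exact pos_iff_and_neg_iff_of_fl_eq hfl H.isFloat₂ h1
    · -- `σ > ½eps⁻¹eta`: `|τ₂ + Σ p′ᵢ| ≤ eps|τ₁| + (2ᴹ − 2)epsσ < |τ₁|` as `|τ₁| ≥ 2ᴹepsσ` and `2ᴹeps < 1`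
      obtain ⟨k, hk, hσk⟩ := H.two_zpow
      obtain ⟨t, τ, -, -, -, -, -, -, hs, h12, -, hτ₂le⟩ := H.last
      have hexit := H.exit hσN
      have hu0 : 0 < unitRoundoff p := u_pos
      have hσ0 : 0 < σ := hσk ▸ two_zpow_pos k
      set u := unitRoundoff p with hu
      set m : ℚ := (2 : ℚ) ^ Nat.clog 2 (xs.length + 2) with hm
      have hnm : (xs.length : ℚ) + 2 ≤ m := by rw [hm]; exact_mod_cast hnM
      -- `2ᴹeps < 1`
      have hmu : m * u < 1 := by
        have h1 : (2 : ℚ) ^ Nat.clog 2 (xs.length + 2) < 2 ^ p := pow_lt_pow_right₀ (by norm_num) hM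
        rw [hm, hu, unitRoundoff, ← mul_div_assoc, mul_one, div_lt_one (by positivity)]
        exact h1
      have hτ₂abs : |τ₂| ≤ u * |τ₁| := hτ₂le.trans (mul_le_mul_of_nonneg_left (ufp_le_abs τ₁) hu0.le)
      have hsum : |xs'.sum| ≤ xs.length * (u * σ) := by
        have h1 := abs_list_sum_le xs'
        have h2 := List.sum_le_card_nsmul (xs'.map abs) (u * σ) (by
          intro y hy
          rw [List.mem_map] at hy
          obtain ⟨x, hx, rfl⟩ := hy
          exact (H.low x hx).2)
        rw [List.length_map, H.length_eq, nsmul_eq_mul] at h2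
        exact h1.trans h2
      have hlt : |τ₂ + xs'.sum| < |τ₁| := by
        have h1 : |τ₂ + xs'.sum| ≤ u * |τ₁| + xs.length * (u * σ) :=
          (abs_add_le _ _).trans (add_le_add hτ₂abs hsum)
        have h2 : (xs.length : ℚ) * (u * σ) ≤ (m - 2) * (u * σ) :=
          mul_le_mul_of_nonneg_right (by linarith only [hnm]) (mul_nonneg hu0.le hσ0.le)
        -- `(2ᴹ − 2)epsσ < (1 − eps)|τ₁|` since `(1 − eps)2ᴹepsσ − (2ᴹ − 2)epsσ = epsσ(2 − 2ᴹeps) > 0`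
        have h3 : (1 - u) * (m * u * σ) ≤ (1 - u) * |τ₁| :=
          mul_le_mul_of_nonneg_left hexit (by linarith only [(u_le_one : u ≤ 1)])
        have h4 : 0 < u * σ * (2 - m * u) := mul_pos (mul_pos hu0 hσ0) (by linarith only [hmu])
        linarith only [h1, h2, h3, h4]
      have hs' : xs.sum = τ₁ + (τ₂ + xs'.sum) := by rw [hs, ← h12]; ring
      rw [hs']
      have := pos_iff_and_neg_iff_of_abs_lt hlt
      exact ⟨this.1.symm, this.2.symm⟩

/-- **THEOREM 4.2.** Let `S` be the result of Algorithm 4.1 (`AccSign`) applied to a vector of floating-point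
numbers `pᵢ, 1 ≤ i ≤ n`, and assume `2ᴹeps < 1` for `M := ⌈log₂(n + 2)⌉`. Then `AccSign` stops (the loop ends
within the fuel supplied, Lemma 3.4) and (4.1) `S = sign(Σ pᵢ)`. The optimality example (4.3) for `Φ` is discussed
in the header NOTES. [cite: RumpOgitaOishi2009, Theorem 4.2 eq. (4.1)] -/
theorem accSign_eq_sign_sum (hfl : IsRoundNearest p emin fl) {xs : List ℚ}
    (hxs : ∀ x ∈ xs, IsFloat p emin x) (hM : Nat.clog 2 (xs.length + 2) < p) :
    accSign fl p emin xs = SignType.sign xs.sum := by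
  obtain ⟨h1, h2⟩ := transformPhi_fst_pos_iff_and_neg_iff hfl hxs hM
  rw [accSign]
  set τ₁ := (transformPhi fl p emin (2 ^ Nat.clog 2 (xs.length + 2) * unitRoundoff p) xs 0).1
  rcases lt_trichotomy xs.sum 0 with h | h | h
  · rw [sign_neg h, sign_neg (h2.mpr h)]
  · have hτ : τ₁ = 0 := by
      rcases lt_trichotomy τ₁ 0 with h' | h' | h'
      · exact absurd (h2.mp h') (by rw [h]; exact lt_irrefl 0)
      · exact h'
      · exact absurd (h1.mp h') (by rw [h]; exact lt_irrefl 0)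
    rw [h, hτ, sign_zero]
  · rw [sign_pos h, sign_pos (h1.mpr h)]

/-- **THEOREM 4.2** as the three cases: `S = 1 ⟺ Σ pᵢ > 0`, `S = −1 ⟺ Σ pᵢ < 0`, `S = 0 ⟺ Σ pᵢ = 0` — in
particular `AccSign` decides `Σ pᵢ = 0` exactly. [cite: RumpOgitaOishi2009, Theorem 4.2 eq. (4.1)] -/
theorem accSign_eq_iff (hfl : IsRoundNearest p emin fl) {xs : List ℚ}
    (hxs : ∀ x ∈ xs, IsFloat p emin x) (hM : Nat.clog 2 (xs.length + 2) < p) :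
    (accSign fl p emin xs = 1 ↔ 0 < xs.sum) ∧ (accSign fl p emin xs = -1 ↔ xs.sum < 0) ∧
      (accSign fl p emin xs = 0 ↔ xs.sum = 0) := by
  rw [accSign_eq_sign_sum hfl hxs hM]
  exact ⟨sign_eq_one_iff, sign_eq_neg_one_iff, sign_eq_zero_iff⟩

end Literature.ComputerArithmetic.RumpOgitaOishi2009
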